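import Mathlib
import HarnessLib
import Literature.NumberTheory.Automorphic.AutomorphicRepsGL2WeightOneCleanModel
import Literature.NumberTheory.Automorphic.NewformAdelisationHeckeOperator
import Literature.NumberTheory.Automorphic.CertifiedMaassHeckeTraceCensus
import Literature.NumberTheory.Automorphic.StrongArtinCentralCharacter
import Literature.NumberTheory.Automorphic.WeightOneDescent
import Summits.Langlands.Langlands.Theorems.QuarterDeficit1951CorrespondentFingerprintStubDescentAux3
import Summits.Langlands.Langlands.Theorems.QuarterDeficit1951CorrespondentFingerprintStubDescentAux4
import Summits.Langlands.Langlands.Theorems.QuarterDeficit1951CorrespondentFingerprintStubDescentAux5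

/-!
# Crux `CorrespondentFingerprint` (stmt-Langlands-15898), line `Sketch`: stub `stub_descent`
# — the weight-`0` descent `φ₀ ↦ u` (Maass form dictionary `π ↦ u_π`)

Let `φ₀` be a non-zero cusp form on `GL₂(𝔸_ℚ)` which is `K₁(N)`-fixed, has central character
`ψ_{χ₁} = HeckeCharacter.ofDirichlet χ₁`, is `A_G`-invariant, archimedean-smooth, of `SO(2)`-weight
`0` along `ι_𝔸`, killed by `Z`, with Casimir `Ω φ₀ = c φ₀`.  Then `u(τ) = φ₀((g_τ, 1))`,
`g_τ = (y x; 0 1)`, is a weight-`0` Maass cusp form on `(Γ₀(N), χ₁)` (`IsMaassCuspFormOn`) of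
Laplace eigenvalue `-c/2`, non-zero, and the unramified Hecke operators descend:
`T_{v,1} φ₀ = c₁ φ₀`, `T_{v,2} φ₀ = c₂ φ₀` give `T_p u = (c₁/√p) u` and `c₂ = χ₁(p)`.
Assembled from the auxiliary files: nebentypus along `Γ₀(N)` (Aux1, `K₀(N) = Z(𝒪̂ˣ) K₁(N)`),
the archimedean part (Aux2: `C²`, automorphy, non-vanishing, boundedness), `Ω = 2Δ` on weight-`0`
vectors (Aux3), the Hecke dictionary (Aux4, Gelbart 1975, Lemma 3.7) and cuspidality at every cusp
(Aux5, the adelic cusp condition over the box `[0, N) × N ẑ`).  Theorem only; no `sorry`.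
-/

set_option linter.dupNamespace false

noncomputable section

open scoped BigOperators Matrix NumberField MatrixGroups NNReal Classical
open Literature.NumberTheory.Automorphic Literature.NumberTheory.GaloisRepresentations
  IsDedekindDomain NumberField
open Literature.NumberTheory.Automorphic.GL2Real
open Rat.HeightOneSpectrum

namespace Summit.Langlands.Langlands.Theorems.CorrespondentFingerprint

/-- **STUB `stub_descent`** (NewformDictionary, weight `0`, nebentypus): let `φ₀` be a non-zero cusp
form on `GL₂(𝔸_ℚ)` which is `K₁(N)`-fixed, has central character `ψ_{χ₁}` (`χ₁` mod `N`), is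
`A_G`-invariant, archimedean-smooth, of `SO(2)`-weight `0` along `ι_𝔸`, killed by `Z`, with Casimir
`Ω φ₀ = c φ₀` (`c` real).  Then `u(τ) = φ₀((y x; 0 1)_∞ × 1_f)` is a weight-`0` Maass cusp form on
`(Γ₀(N), χ₁)` — `u(γ τ) = χ₁(d) u(τ)` — of Laplace eigenvalue `λ = -c/2` (`Ω = ½h² + E₁₂E₂₁ + E₂₁E₁₂`
acts on right-`SO(2)`-invariant `Z`-invariant functions as `2y²(∂ₓ² + ∂_y²)`), cuspidal at every cusp
(adelic cusp condition of `φ₀` over the box `[0, N) × N ẑ` at `(g_{iy}, (g₀)_f⁻¹)`), bounded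
(`cuspidal_bounded_holds`), non-zero (`GL₂(𝔸_ℚ) = GL₂(ℚ)(GL₂(ℝ)⁺ K₁(N))`); and the Hecke operators
descend: if `T_{v,1} φ₀ = c₁ φ₀` and `T_{v,2} φ₀ = c₂ φ₀` (`v = p ∤ N`, operators of `HasSatakeParamAt`
at level `K(N)`) then `T_p u = (c₁ / √p) u` for the classical `T_p` with nebentypus `χ₁`
(`maassHeckeOp`, unitary normalisation) and `c₂ = χ₁(p)`. [cite: Gelbart1975, §3, Prop. 3.1, Lemma 3.7]
[cite: Bump1997, §2.2, §3.2, §3.6] [cite: BookerLeeStrombergsson2020, §1.1] -/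
theorem stub_descent : ∀ (hcpt : isCompact_glFiniteIntegralLevel 2 ℚ) (N : ℕ) [NeZero N]
    (χ₁ : DirichletCharacter ℂ N) (c : ℝ) (φ₀ : (AdelicGroupData.gl 2 ℚ).Adelic → ℂ),
    φ₀ ∈ cuspFormsGL 2 ℚ hcpt → φ₀ ≠ 0 →
    (∀ u ∈ gammaOneFiniteLevel ℚ (Ideal.span {(N : 𝓞 ℚ)}),
      rightTranslation (AdelicGroupData.gl 2 ℚ)
          (show (AdelicGroupData.gl 2 ℚ).Adelic from GLn.ofFinite 2 ℚ u) φ₀ = φ₀) →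
    (∀ z : ideleGroup ℚ,
      rightTranslation (AdelicGroupData.gl 2 ℚ) (Matrix.GeneralLinearGroup.scalar (Fin 2) z) φ₀ =
        ((HeckeCharacter.ofDirichlet χ₁ z : ℂˣ) : ℂ) • φ₀) →
    (∀ z ∈ (AdelicGroupData.gl 2 ℚ).center', ∀ g, φ₀ (z * g) = φ₀ g) →
    IsArchSmooth Rat.iotaA φ₀ → IsWeightVec Rat.iotaA 0 φ₀ → lieDeriv Rat.iotaA (toLie 1) φ₀ = 0 →
    casimirFun Rat.iotaA φ₀ = (c : ℂ) • φ₀ →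
    let u : UpperHalfPlane → ℂ := fun τ => φ₀ (Rat.ofRealGLA (upperHalfPlaneToGL τ))
    IsMaassCuspFormOn N χ₁ u (-c / 2) ∧ (∃ z, u z ≠ 0) ∧
      ∀ v : HeightOneSpectrum (𝓞 ℚ), ¬ v.asIdeal ∣ Ideal.span {(N : 𝓞 ℚ)} → ∀ c₁ c₂ : ℂ,
        heckeOperator (rightTranslation (AdelicGroupData.gl 2 ℚ))
            (show Subgroup (AdelicGroupData.gl 2 ℚ).Adelic from
              principalCongruenceLevel 2 ℚ (Ideal.span {(N : 𝓞 ℚ)}))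
            (heckeDiagAt 2 ℚ v (Rat.localUniformizer v) 1) φ₀ = c₁ • φ₀ →
        heckeOperator (rightTranslation (AdelicGroupData.gl 2 ℚ))
            (show Subgroup (AdelicGroupData.gl 2 ℚ).Adelic from
              principalCongruenceLevel 2 ℚ (Ideal.span {(N : 𝓞 ℚ)}))
            (heckeDiagAt 2 ℚ v (Rat.localUniformizer v) 2) φ₀ = c₂ • φ₀ →
        (∀ z, maassHeckeOp N χ₁ (natGenerator v) u z =
            (c₁ / (((Real.sqrt (natGenerator v : ℝ)) : ℝ) : ℂ)) * u z) ∧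
          c₂ = χ₁ ((natGenerator v : ℕ) : ZMod N) := by
  intro hcpt N _ χ₁ c φ₀ hcusp hne hK hcen hAG hs hw hZ hcas u
  have hsm : IsArchSmooth incl fun x : GL (Fin 2) ℝ => φ₀ (Rat.ofRealGL 2 x) := isArchSmooth_incl_ofRealGL hs
  refine ⟨⟨isC2_comp_upperHalfPlaneToGL hsm, descent_eigen hs hw hZ hcas,
    fun γ hγ z => descent_slash χ₁ hcusp hK hcen hs hw hZ γ hγ z,
    fun g y hy => descent_cuspidal hcusp hK hs hw hZ g hy, descent_bounded hcusp hAG⟩,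
    descent_ne_zero hcusp hne hK hs hw hZ, fun v hv c₁ c₂ hT1 hT2 => ?_⟩
  exact ⟨fun z => descent_hecke_one χ₁ hcusp hK hcen hs hw hZ hv hT1 z, descent_hecke_two χ₁ hne hK hcen hv hT2⟩

/-- **Registered stub `stub_descent_main`** (= `stub_descent`; registered with a parseable `let … ;`). [folklore] -/
theorem stub_descent_main : ∀ (hcpt : isCompact_glFiniteIntegralLevel 2 ℚ) (N : ℕ) [NeZero N] (χ₁ : DirichletCharacter ℂ N) (c : ℝ) (φ₀ : (AdelicGroupData.gl 2 ℚ).Adelic → ℂ), φ₀ ∈ cuspFormsGL 2 ℚ hcpt → φ₀ ≠ 0 → (∀ u ∈ gammaOneFiniteLevel ℚ (Ideal.span {(N : 𝓞 ℚ)}), rightTranslation (AdelicGroupData.gl 2 ℚ) (show (AdelicGroupData.gl 2 ℚ).Adelic from GLn.ofFinite 2 ℚ u) φ₀ = φ₀) → (∀ z : ideleGroup ℚ, rightTranslation (AdelicGroupData.gl 2 ℚ) (Matrix.GeneralLinearGroup.scalar (Fin 2) z) φ₀ = ((HeckeCharacter.ofDirichlet χ₁ z : ℂˣ) : ℂ)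 • φ₀) → (∀ z ∈ (AdelicGroupData.gl 2 ℚ).center', ∀ g, φ₀ (z * g) = φ₀ g) → IsArchSmooth Rat.iotaA φ₀ → IsWeightVec Rat.iotaA 0 φ₀ → lieDeriv Rat.iotaA (toLie 1) φ₀ = 0 → casimirFun Rat.iotaA φ₀ = (c : ℂ) • φ₀ → let u : UpperHalfPlane → ℂ := fun τ => φ₀ (Rat.ofRealGLA (upperHalfPlaneToGL τ)); IsMaassCuspFormOn N χ₁ u (-c / 2) ∧ (∃ z, u z ≠ 0) ∧ ∀ v : HeightOneSpectrum (𝓞 ℚ), ¬ v.asIdeal ∣ Ideal.span {(N : 𝓞 ℚ)} → ∀ c₁ c₂ : ℂ, heckeOperator (rightTranslation (AdelicGroupData.gl 2 ℚ)) (show Subgroup (AdelicGroupData.gl 2 ℚ).Adelic from principalCongruenceLevel 2 ℚ (Ideal.span {(N : 𝓞 ℚ)})) (heckeDiagAt 2 ℚ v (Rat.localUniformizer v) 1) φ₀ = c₁ • φ₀ → heckeOperator (rightTranslation (AdelicGroupData.gl 2 ℚ)) (show Subgroup (AdelicGroupData.gl 2 ℚ).Adelic from principalCongruenceLevel 2 ℚ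 (Ideal.span {(N : 𝓞 ℚ)})) (heckeDiagAt 2 ℚ v (Rat.localUniformizer v) 2) φ₀ = c₂ • φ₀ → (∀ z, maassHeckeOp N χ₁ (natGenerator v) u z = (c₁ / (((Real.sqrt (natGenerator v : ℝ)) : ℝ) : ℂ)) * u z) ∧ c₂ = χ₁ ((natGenerator v : ℕ) : ZMod N) :=
  stub_descent

end Summit.Langlands.Langlands.Theorems.CorrespondentFingerprint
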